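import Literature.AlgebraicGeometry.HodgeTheory.AmpleDivisorChernClassNeZero
import Literature.AlgebraicGeometry.HodgeTheory.HardLefschetzNFoldHolds
import Literature.AlgebraicGeometry.HodgeTheory.KaehlerClass
import HarnessLib

/-!
# The class of an AMPLE divisor satisfies hard Lefschetz: `θ ∈ ℚˣ·[Θ]` is a polarisation class
# (`IsPolarizationClass n X θ`: rational, in `N¹H²`, hard Lefschetz in dimension `n`)

Family `hodge`, layer `Literature/AlgebraicGeometry/HodgeTheory`. In print: for an ample line bundle `L`
on a smooth projective complex `n`-fold `X`, `c₁(L)` is (a positive multiple of) a Kähler class — the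
restriction of the Fubini–Study class along the embedding given by a very ample power (Voisin I §3.3.2
Lemma 3.16, §7.1.2 Thm. 7.10; Kodaira) — hence has the HARD LEFSCHETZ property `Lⁿ⁻ᵏ : Hᵏ ⥲ H²ⁿ⁻ᵏ`
(Voisin I Thm. 6.25) and is a polarisation class in the sense of André (*Pour une théorie inconditionnelle
des motifs*, §1.1: «`η = c₁(𝓛_X)` d'un faisceau inversible ample»), the tree's `IsPolarizationClass n X η`
(`HodgeTheory/MotivatedClasses`). The tree had the hard Lefschetz datum only for the hyperplane-type class
of a projective embedding (`nonempty_hardLefschetzNFold_holds`) and the divisor-line notion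
`AbelianVariety.IsPolarizationClassOf Θ θ` (`θ ∈ ℚˣ·[Θ]`, `Motives/AbelianVarietyPrincipalPolarization`)
WITHOUT hard Lefschetz. This file PROVES the bridge, on the real carrier:

* `HodgeModel.hasHardLefschetzProperty_chernCharacter_tautologicalBundle` — **`ch₁ᴬ(𝒪(-1)|_X)` has the hard
  Lefschetz property in dimension `n`** for every closed immersion `ι : X ↪ ℙᴺ` and Hodge model `A`
  (`dim X ≥ 1`): its pull-back to the model is `A.deRham[-θ_ι/2π]`, `θ_ι` the restricted Fubini–Study form
  (`HolomorphicBundleChernCharacterTopDegree`), while the class `H` with `A^*H = e[θ_ι] ⊗ 1` for a natural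
  multiplicative REAL de Rham family `e` is Kähler via `(A, e)` and satisfies hard Lefschetz
  (`IsKaehlerClassVia.hasHardLefschetzProperty`, hodge.S14); the two natural comparisons `A.deRham` and
  `e ⊗ ℂ` differ by a scalar on the compact manifold `X^an` (`NaturalDeRhamComparisonRigidity_holds`), so
  `ch₁ᴬ(𝒪(-1)|_X) = s • H` with `s ≠ 0`, and hard Lefschetz is invariant under non-zero scalars
  (`HasHardLefschetzProperty.smul`);
* `hasHardLefschetzProperty_chernCharacter_cartierDivisorCocycle_of_isAmple` — **`ch₁ᴬ(𝒪_X(Θ))` satisfies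
  hard Lefschetz for `Θ` AMPLE** (`q • Θ ∼ H_ι`, `Motives/AmpleDivisorVeryAmpleMultiple`;
  `q · ch(Θ) = ch(H_ι) = -ch₁(𝒪(-1)|_X)`);
* `isPolarizationClass_of_isAmple_of_isDivisorClassLineOf` — **every non-zero rational class on the line
  `ℂ·c₁(𝒪_X(Θ))` of an ample `Θ` is a polarisation class `IsPolarizationClass n X θ`**;
* abelian varieties: `AbelianVariety.IsPolarizationClassOf.isPolarizationClass` (`Θ` ample),
  **`AbelianVariety.IsPrincipalPolarizationClass.isPolarizationClass`** — a principal polarisation class IS a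
  polarisation class in André's sense (rational, `N¹`, hard Lefschetz in dimension `dim A`) —,
  `AbelianVariety.exists_isPolarizationClassOf_isPolarizationClass_of_isAmple`; Jacobians (modulo the Riemann
  fact of `Motives/JacobianThetaDivisor`): `Jacobian.exists_principalPolarizationClass_isPolarizationClass_of_riemann`.

Consumers: the ring-2 anchor predicates (`IsSecantQuotientWeilClassAt(Pinned)`: the clause
`IsPolarizationClass 6 X θ` follows from the clause "`θ` is the polarisation class of an ample divisor on
`Y_d`" by this file and `IsPolarizationClass.map_of_iso`); Weil-type data asking `IsPolarizationClass` of a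
divisor class. Everything is proved; no definition, no named fact. NOT here: Hodge–Riemann / positivity
(the sign of `θ` is not captured by the tree's `c₁`, module docstring of `CartierDivisorChernClassRational`).

## References

* [VoisinHodgeI2002] C. Voisin, *Hodge Theory and Complex Algebraic Geometry I* (CUP 2002), §3.3.2
  Lemma 3.16, Thm. 6.25, Rem. 6.27, §7.1.2 Thm. 7.10, Thm. 11.33.
* [Andre1996Motifs] Y. André, Publ. Math. IHÉS 83 (1996), §1.1 (p. 10).
* [Lange2023AbelianVarietiesComplex] H. Lange, *Abelian Varieties over the Complex Numbers* (2023), §2.1.1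
  (p. 68), §4.2.1.
* [Hartshorne1977] R. Hartshorne, *Algebraic Geometry*, II Thm. 7.6 (p. 154).
* [Milnor1963] J. Milnor, *Morse Theory*, §3, §5 (rigidity of natural comparisons, via
  `NaturalDeRhamComparisonRigidity_holds`).
* Tree: `HardLefschetzNFoldHolds`, `KaehlerClass`, `HolomorphicBundleChernCharacterTopDegree`,
  `HyperplaneClassRational`, `AmpleDivisorChernClassNeZero`, `Motives/AmpleDivisorVeryAmpleMultiple`.
-/

noncomputable section

open scoped Manifold ContDiff
open CategoryTheory AlgebraicGeometry

namespace Literature.AlgebraicGeometry.HodgeTheory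

section HodgeTheory

open Literature.AlgebraicTopology.SingularHomology Literature.Geometry.Kaehler
open Literature.NumberTheory.Transcendental
open Literature.AlgebraicGeometry.Motives (projectiveSpace IsSmoothProjective kaehlerFormPow kaehlerFormPow_one)
open Literature.AlgebraicGeometry.Motives.AnalytificationKaehler

variable {n : ℕ} {X : Motives.SchemeOver ℂ}

namespace HodgeModel

/-- `X^an` is compact for `X` smooth projective (local copy of `HodgeModel.compactSpace_carrier`).
[cite: SerreGAGA1956, §2 n°7 Prop. 6] -/
private theorem compactSpace_carrier₃ (A : HodgeModel n X) (hX : IsSmoothProjective n X) :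
    CompactSpace A.carrier :=
  haveI := Motives.ComplexPoints.compactSpace_of_isSmoothProjective hX
  A.isAnalytification.homeomorph.symm.compactSpace

/-- **The comparison of the Hodge model and the complexification of a natural real de Rham family differ by
a scalar**: `A.deRham = r • (e ⊗ ℂ)` on `Hᵏ_dR(X^an; ℂ)` (rigidity of natural de Rham comparisons on the
compact manifold `X^an`, `NaturalDeRhamComparisonRigidity_holds`, along the identity). [cite: Milnor1963, Thm. 3.5 and §5] -/
private theorem exists_deRham_eq_smul_complexify (hX : IsSmoothProjective n X) (A : HodgeModel n X)
    (e : DeRhamIsoFamily 𝓘(ℝ, A.model)) (he : e.IsNatural) (k : ℕ) :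
    ∃ r : ℂ, ∀ y : complexDeRhamCohomology A.model A.carrier k,
      A.deRham A.carrier k y = r • e.complexify A.carrier k y := by
  haveI : CompactSpace A.carrier := compactSpace_carrier₃ A hX
  obtain ⟨r, hr⟩ := NaturalDeRhamComparisonRigidity_holds A.model A.model e.complexify
    (DeRhamIsoFamily.complexify_isNatural he) A.deRham A.deRham_isNatural A.carrier A.carrier
    (Homeomorph.refl A.carrier) contMDiff_id contMDiff_id k
  refine ⟨r, fun y ↦ ?_⟩
  have h := hr y
  have h1 : (⟨Homeomorph.refl A.carrier, (Homeomorph.refl A.carrier).continuous⟩ : C(A.carrier, A.carrier)) =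
      ContinuousMap.id A.carrier := rfl
  have h2 : complexDeRhamCohomology.map A.model
      (contMDiff_id : ContMDiff 𝓘(ℝ, A.model) 𝓘(ℝ, A.model) ∞ (Homeomorph.refl A.carrier)) k =
        LinearMap.id :=
    complexDeRhamCohomology.map_id (E := A.model) (M := A.carrier) k
  have lhs : singularCohomology.map ℂ ℂ
      (⟨Homeomorph.refl A.carrier, (Homeomorph.refl A.carrier).continuous⟩ : C(A.carrier, A.carrier)) k
        (A.deRham A.carrier k y) = A.deRham A.carrier k y := by
    rw [h1, singularCohomology.map_id]
    rfl
  have rhs : e.complexify A.carrier k (complexDeRhamCohomology.map A.model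
      (contMDiff_id : ContMDiff 𝓘(ℝ, A.model) 𝓘(ℝ, A.model) ∞ (Homeomorph.refl A.carrier)) k y) =
        e.complexify A.carrier k y :=
    congrArg (e.complexify A.carrier k) (LinearMap.congr_fun h2 y)
  exact lhs.symm.trans (h.trans (congrArg (r • ·) rhs))

/-- **`ch₁ᴬ(𝒪(-1)|_X)` satisfies hard Lefschetz.** For `X` smooth projective of dimension `n ≥ 1`, a Hodge
model `A` and a closed immersion `ι : X ↪ ℙᴺ`, the first Chern character `c_ι = ch₁ᴬ(𝒪(-1)|_{X^an})` of
the tautological cocycle (`HolomorphicBundleChernCharacterTopDegree`) has the hard Lefschetz property in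
dimension `n` on `H^*(X(ℂ); ℂ)`: `A^*c_ι = A.deRham[-θ_ι/2π]` with `θ_ι` the restricted Fubini–Study form
(`pullback_chernCharacter`, `isChernCharacterForm_tautologicalConnection`), the Kähler class `H` with
`A^*H = e[θ_ι] ⊗ 1` has hard Lefschetz (Voisin I Thm. 6.25 = hodge.S14,
`IsKaehlerClassVia.hasHardLefschetzProperty`), and `c_ι = s • H`, `s ≠ 0`, by rigidity of the two natural
comparisons `A.deRham`, `e ⊗ ℂ`. [cite: VoisinHodgeI2002, Thm. 6.25, Rem. 6.27 and §3.3.2 Lemma 3.16] -/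
theorem hasHardLefschetzProperty_chernCharacter_tautologicalBundle (hX : IsSmoothProjective n X)
    (A : HodgeModel n X) (hn : 1 ≤ n) {N : ℕ} (ι : X ⟶ projectiveSpace N ℂ) [IsClosedImmersion ι.left] :
    HasHardLefschetzProperty
      (A.chernCharacter (tautologicalBundle ι A.isAnalytification) 1 : complexBetti X 2) n := by
  -- (1) the Kähler class `H` of `(A, e)` with `A^*H = e[θ_ι] ⊗ 1`, and its hard Lefschetz property
  obtain ⟨e, he, hem, -⟩ := exists_deRhamIsoFamily_holds A.model
  have hθ := A.fubiniStudyPullbackForm_mem_closedSmoothForms ι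
  obtain ⟨H, hH⟩ := A.pullback_surjective 2 (ofRealClass A.carrier 2 (e A.carrier 2
    (deRhamCohomology.mk ⟨fubiniStudyPullbackForm A.model ι A.toComplexPoints, hθ⟩)))
  have hK : A.IsKaehlerClassVia e H := A.isKaehlerClassVia_of_pullback_eq_fubiniStudyPullbackForm e hX ι hθ hH
  have hHL : HasHardLefschetzProperty H n :=
    hK.hasHardLefschetzProperty hX Motives.hasHardLefschetzProperty_kaehlerClass_holds he hem
  -- (2) `A^* c_ι = A.deRham[κ • ω_g ⊗ 1]`, `ω_g = θ_ι`, `κ = -1/2π`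
  obtain ⟨g, hgK, hg⟩ := A.exists_isKaehler_kaehlerForm_eq_fubiniStudyPullbackForm hX ι
  set κ : ℂ := ((1 : ℕ).factorial : ℂ)⁻¹ * (-(2 * (Real.pi : ℂ))⁻¹) ^ 1 with hκ
  have hs := A.isSmoothForm_smul_kaehlerFormPow_ofReal g κ 1
  have hcl := A.isClosedForm_smul_kaehlerFormPow_ofReal g hgK κ 1
  have hch := A.pullback_chernCharacter (tautologicalBundle ι A.isAnalytification) 1
    (tautologicalConnection ι A.isAnalytification) hs hcl (A.isChernCharacterForm_tautologicalConnection ι g hg 1)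
  have hcl' := A.kaehlerFormPow_mem_closedSmoothForms g hgK 1
  have key : complexDeRhamCohomology.mk A.model A.carrier (2 * 1)
      ⟨κ • (kaehlerFormPow g.toRiemannianMetric 1).ofReal, mem_cclosedSmoothForms hs hcl⟩ =
      κ • complexDeRhamCohomology.ofReal A.model A.carrier (2 * 1)
        (deRhamCohomology.mk ⟨kaehlerFormPow g.toRiemannianMetric 1, hcl'⟩) := by
    rw [complexDeRhamCohomology.ofReal_mk, ← LinearMap.map_smul]
    rfl
  have heqθ : (deRhamCohomology.mk ⟨kaehlerFormPow g.toRiemannianMetric 1, hcl'⟩ :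
      deRhamCohomology 𝓘(ℝ, A.model) A.carrier ℝ (2 * 1)) =
        deRhamCohomology.mk ⟨fubiniStudyPullbackForm A.model ι A.toComplexPoints, hθ⟩ := by
    have hsub : (⟨kaehlerFormPow g.toRiemannianMetric 1, hcl'⟩ :
        closedSmoothForms 𝓘(ℝ, A.model) A.carrier ℝ (2 * 1)) =
          ⟨fubiniStudyPullbackForm A.model ι A.toComplexPoints, hθ⟩ := by
      apply Subtype.ext
      change kaehlerFormPow g.toRiemannianMetric 1 = fubiniStudyPullbackForm A.model ι A.toComplexPoints
      rw [kaehlerFormPow_one]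
      exact hg
    rw [hsub]
  -- (3) rigidity `A.deRham = r • (e ⊗ ℂ)` and the identity `c_ι = (κ r) • H`
  obtain ⟨r, hr⟩ := exists_deRham_eq_smul_complexify hX A e he (2 * 1)
  have hc : (A.chernCharacter (tautologicalBundle ι A.isAnalytification) 1 : complexBetti X 2) = (κ * r) • H := by
    apply A.pullback_injective (2 * 1)
    rw [hch, key, map_smul, heqθ, hr, complexify_apply, complexifyFun_ofReal, smul_smul, map_smul]
    exact congrArg ((κ * r) • ·) hH.symm
  -- (4) `κ r ≠ 0` since `c_ι ≠ 0` (`dim X ≥ 1`)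
  have hc0 : (A.chernCharacter (tautologicalBundle ι A.isAnalytification) 1 : complexBetti X 2) ≠ 0 := by
    obtain ⟨c', hc', hc'0⟩ := HodgeModel.exists_mem_chernCharacterSet_tautologicalBundle_ne_zero ι A hX (p := 1) hn
    rw [A.chernCharacter_eq_of_mem hc']
    exact hc'0
  have hκr : κ * r ≠ 0 := by
    intro h0
    exact hc0 (by rw [hc, h0, zero_smul])
  rw [hc]
  exact HasHardLefschetzProperty.smul hHL hκr

end HodgeModel

/-- **The class of an ample divisor satisfies hard Lefschetz.** For `X` smooth projective of dimension
`n ≥ 1` with Hodge model `A` and `Θ` an AMPLE Cartier divisor on `X`, `ch₁ᴬ(𝒪_X(Θ)^an) ∈ H²(X(ℂ); ℂ)` has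
the hard Lefschetz property in dimension `n`: some `q • Θ`, `q ≥ 1`, is linearly equivalent to the
hyperplane divisor `H_ι` of a closed immersion `ι : X ↪ ℙᴺ` (Hartshorne II Thm. 7.6,
`CartierDivisor.IsAmple.exists_pos_smul_linEquiv_hyperplaneDivisor`), so
`q · ch(Θ) = ch(H_ι) = -ch₁(𝒪(-1)|_X)` and the previous theorem applies (scalars `≠ 0`). In print: `c₁` of
an ample line bundle is a Kähler class (Voisin I Thm. 7.10), and Kähler classes satisfy hard Lefschetz
(Thm. 6.25). [cite: VoisinHodgeI2002, Thm. 6.25 with §7.1.2 Thm. 7.10 and Thm. 11.33] [cite: Hartshorne1977, II Thm. 7.6 (p. 154)] -/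
theorem hasHardLefschetzProperty_chernCharacter_cartierDivisorCocycle_of_isAmple [IsIntegral X.left]
    (hX : IsSmoothProjective n X) (A : HodgeModel n X) (hn : 1 ≤ n) {Θ : Motives.CartierDivisor X.left}
    (hΘ : Θ.IsAmple) :
    HasHardLefschetzProperty
      (A.chernCharacter (cartierDivisorCocycle A.isAnalytification Θ) 1 : complexBetti X 2) n := by
  haveI : IsProper X.hom := Motives.IsSmoothProjective.isProper_holds hX
  obtain ⟨q, hq, N, ι, hι, a₀, ha₀, hlin⟩ := hΘ.exists_pos_smul_linEquiv_hyperplaneDivisor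
  haveI := hι
  -- `q • ch(Θ) = ch(H_ι) = -c_ι`, so `ch(Θ) = (-q⁻¹) • c_ι`
  have h1 := A.chernCharacter_cartierDivisorCocycle_eq_of_linEquiv hlin
  rw [A.chernCharacter_cartierDivisorCocycle_smul, A.chernCharacter_cartierDivisorCocycle_divisor_eq_neg ι a₀ ha₀]
    at h1
  have hq0 : (q : ℂ) ≠ 0 := by exact_mod_cast hq.ne'
  have h2 : (A.chernCharacter (cartierDivisorCocycle A.isAnalytification Θ) 1 : complexBetti X 2) =
      (-(q : ℂ)⁻¹) • (A.chernCharacter (tautologicalBundle ι A.isAnalytification) 1 : complexBetti X 2) := by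
    have e1 : (A.chernCharacter (cartierDivisorCocycle A.isAnalytification Θ) 1 : complexBetti X 2) =
        (q : ℂ)⁻¹ • ((q : ℂ) • A.chernCharacter (cartierDivisorCocycle A.isAnalytification Θ) 1) := by
      rw [smul_smul, inv_mul_cancel₀ hq0, one_smul]
    rw [e1, h1, smul_neg, neg_smul]
  rw [h2]
  exact HasHardLefschetzProperty.smul (A.hasHardLefschetzProperty_chernCharacter_tautologicalBundle hX hn ι)
    (neg_ne_zero.2 (inv_ne_zero hq0))

/-- **Every non-zero rational class on the line `ℂ·c₁(𝒪_X(Θ))` of an AMPLE divisor `Θ` is a polarisation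
class** in André's sense (`IsPolarizationClass n X θ`: rational, supported on a divisor, hard Lefschetz in
dimension `n`; André 1996 §1.1: «la classe `η = c₁(𝓛_X)` d'un faisceau inversible ample»). The line notion
is `IsDivisorClassLineOf n X Θ θ` of `Motives/AbelianVarietyPrincipalPolarization` (`θ = c • ch^M(Θ)` for some
Hodge model `M`); `θ ≠ 0` forces `dim X ≥ 1` and `c ≠ 0`. [cite: Andre1996Motifs, §1.1 (p. 10)]
[cite: VoisinHodgeI2002, Thm. 6.25 with §7.1.2 Thm. 7.10] -/
theorem isPolarizationClass_of_isAmple_of_isDivisorClassLineOf [IsIntegral X.left] (hX : IsSmoothProjective n X)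
    {Θ : Motives.CartierDivisor X.left} (hΘ : Θ.IsAmple) {θ : complexBetti X 2} (hrat : IsRationalClass θ)
    (hne : θ ≠ 0) (hline : Motives.IsDivisorClassLineOf n X Θ θ) : IsPolarizationClass n X θ := by
  refine ⟨hrat, hline.mem_algebraicClasses, ?_⟩
  obtain ⟨M, c, hθ⟩ := hline
  -- `dim X ≥ 1` (else `H² = 0`)
  have hn : 1 ≤ n := by
    by_contra h
    have hn0 : n = 0 := by omega
    subst hn0
    haveI : Subsingleton (complexBetti X (2 * 1)) :=
      Motives.ComplexPoints.subsingleton_singularCohomology_of_lt hX ℂ (k := 2 * 1) (by omega)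
    exact hne (Subsingleton.elim _ _)
  have hc : c ≠ 0 := by
    rintro rfl
    exact hne (by rw [hθ, zero_smul])
  rw [hθ]
  exact HasHardLefschetzProperty.smul
    (hasHardLefschetzProperty_chernCharacter_cartierDivisorCocycle_of_isAmple hX M hn hΘ) hc

/-- Hence **an ample divisor on a smooth projective `X` of dimension `≥ 1` has a polarisation class in
André's sense on its line `ℂ·c₁(𝒪_X(Θ))`** (the non-zero rational point of the line,
`exists_isRationalClass_ne_zero_isDivisorClassLineOf_of_isAmple`). [cite: Andre1996Motifs, §1.1 (p. 10)]
[cite: VoisinHodgeI2002, Thm. 6.25 with §7.1.2 Thm. 7.10] -/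
theorem exists_isPolarizationClass_isDivisorClassLineOf_of_isAmple [IsIntegral X.left]
    (hX : IsSmoothProjective n X) (hn : 1 ≤ n) {Θ : Motives.CartierDivisor X.left} (hΘ : Θ.IsAmple) :
    ∃ θ : complexBetti X 2, IsPolarizationClass n X θ ∧ Motives.IsDivisorClassLineOf n X Θ θ := by
  obtain ⟨A⟩ := (nonempty_hodgeModel_holds (n := n) (X := X)).nonempty hX
  obtain ⟨ρ, l, -, hρ, hρ0, hline, -⟩ := exists_isRationalClass_ne_zero_isDivisorClassLineOf_of_isAmple hX A hn hΘ
  exact ⟨ρ, isPolarizationClass_of_isAmple_of_isDivisorClassLineOf hX hΘ hρ hρ0 hline, hline⟩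

end HodgeTheory

end Literature.AlgebraicGeometry.HodgeTheory

/-! ### Abelian varieties: polarisation classes of divisors are polarisation classes à la André -/

namespace Literature.AlgebraicGeometry.Motives

namespace AbelianVariety

open Literature.AlgebraicGeometry.HodgeTheory Literature.Geometry.Kaehler
open Literature.AlgebraicTopology.SingularHomology

variable {A : AbelianVariety ℂ}

/-- **A polarisation class `θ ∈ ℚˣ·[Θ]` of an AMPLE divisor `Θ` on a complex abelian variety is a polarisation
class in André's sense**: rational, in `N¹H²`, and HARD LEFSCHETZ in dimension `dim A`
(`IsPolarizationClass A.dim A.X θ`). [cite: Lange2023AbelianVarietiesComplex, §2.1.1 (p. 68)]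
[cite: VoisinHodgeI2002, Thm. 6.25 with §7.1.2 Thm. 7.10] -/
theorem IsPolarizationClassOf.isPolarizationClass {Θ : CartierDivisor A.X.left} {θ : complexBetti A.X 2}
    (h : A.IsPolarizationClassOf Θ θ) (hΘ : Θ.IsAmple) : IsPolarizationClass A.dim A.X θ :=
  isPolarizationClass_of_isAmple_of_isDivisorClassLineOf isSmoothProjective_holds hΘ h.isRationalClass h.ne_zero
    h.isDivisorClassLineOf

/-- In particular **a polarisation class of an ample divisor satisfies hard Lefschetz** in dimension `dim A`.
[cite: VoisinHodgeI2002, Thm. 6.25] -/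
theorem IsPolarizationClassOf.hasHardLefschetzProperty {Θ : CartierDivisor A.X.left} {θ : complexBetti A.X 2}
    (h : A.IsPolarizationClassOf Θ θ) (hΘ : Θ.IsAmple) : HasHardLefschetzProperty θ A.dim :=
  (h.isPolarizationClass hΘ).hasHardLefschetz

/-- **A principal polarisation class IS a polarisation class in André's sense** (`Θ` principal ⟹ ample).
[cite: Lange2023AbelianVarietiesComplex, §2.1.1 (p. 68)] [cite: Andre1996Motifs, §1.1 (p. 10)] -/
theorem IsPrincipalPolarizationClass.isPolarizationClass {θ : complexBetti A.X 2}
    (h : A.IsPrincipalPolarizationClass θ) : IsPolarizationClass A.dim A.X θ := by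
  obtain ⟨Θ, hP, hθ⟩ := h
  exact hθ.isPolarizationClass hP.isAmple

variable (A) in
/-- **Every ample divisor on a complex abelian variety of dimension `≥ 1` has a polarisation class
`θ ∈ ℚˣ·[Θ]` which is a polarisation class in André's sense** (existence by
`exists_isPolarizationClassOf_of_isAmple`, hard Lefschetz by this file). [cite: Lange2023AbelianVarietiesComplex, §2.1.1 (p. 68)]
[cite: VoisinHodgeI2002, Thm. 6.25 with §7.1.2 Thm. 7.10] -/
theorem exists_isPolarizationClassOf_isPolarizationClass_of_isAmple (hd : 1 ≤ A.dim)
    {Θ : CartierDivisor A.X.left} (hΘ : Θ.IsAmple) :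
    ∃ θ : complexBetti A.X 2, A.IsPolarizationClassOf Θ θ ∧ IsPolarizationClass A.dim A.X θ := by
  obtain ⟨θ, hθ⟩ := A.exists_isPolarizationClassOf_of_isAmple hd hΘ
  exact ⟨θ, hθ, hθ.isPolarizationClass hΘ⟩

/-- **A principally polarizable complex abelian variety of dimension `≥ 1` carries a principal polarisation
class which is a polarisation class in André's sense.** [cite: Lange2023AbelianVarietiesComplex, §2.1.1 (p. 68)] -/
theorem IsPrincipallyPolarizable.exists_isPrincipalPolarizationClass_isPolarizationClass
    (h : A.IsPrincipallyPolarizable) (hd : 1 ≤ A.dim) :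
    ∃ θ : complexBetti A.X 2, A.IsPrincipalPolarizationClass θ ∧ IsPolarizationClass A.dim A.X θ := by
  obtain ⟨θ, hθ⟩ := h.exists_isPrincipalPolarizationClass hd
  exact ⟨θ, hθ, hθ.isPolarizationClass⟩

end AbelianVariety

/-! ### Jacobians: the Riemann theta class is a polarisation class à la André (modulo the Riemann fact) -/

namespace Jacobian

open Literature.AlgebraicGeometry.HodgeTheory

/-- **Under Riemann's theorem, the Jacobian of a smooth projective complex curve of genus `≥ 1` carries a
Riemann theta divisor `Θ`, principal, WITH a polarisation class `θ ∈ ℚˣ·[Θ]` which is a polarisation class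
in André's sense** (rational, `N¹`, hard Lefschetz in dimension `g`). [cite: Lange2023AbelianVarietiesComplex, §4.2.1 Lemma 4.2.1 (iii) and §2.1.1]
[cite: VoisinHodgeI2002, Thm. 6.25] -/
theorem exists_principalPolarizationClass_isPolarizationClass_of_riemann
    (h : riemann_brillNoetherLocus_isPrincipalPolarizationDivisor) {C : SchemeOver ℂ} (hC : IsSmoothProjective 1 C)
    (𝒥 : Jacobian C) (hg : 1 ≤ 𝒥.J.dim) :
    ∃ (Θ : CartierDivisor 𝒥.J.X.left) (θ : complexBetti 𝒥.J.X 2),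
      𝒥.IsRiemannThetaDivisor Θ ∧ 𝒥.J.IsPrincipalPolarizationDivisor Θ ∧ 𝒥.J.IsPolarizationClassOf Θ θ ∧
        IsPolarizationClass 𝒥.J.dim 𝒥.J.X θ := by
  obtain ⟨Θ, θ, hR, hP, hθ⟩ := exists_principalPolarizationClass_of_riemann h hC 𝒥 hg
  exact ⟨Θ, θ, hR, hP, hθ, hθ.isPolarizationClass hP.isAmple⟩

end Jacobian

end Literature.AlgebraicGeometry.Motives

end
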